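import Mathlib.Analysis.Calculus.IteratedDeriv.FaaDiBruno
import Mathlib.Analysis.Calculus.IteratedDeriv.Lemmas
import Mathlib.Analysis.Calculus.Deriv.Pow
import Mathlib.Analysis.SpecialFunctions.Trigonometric.Series
import Mathlib.Analysis.Analytic.OfScalars
import Mathlib.Analysis.Analytic.ChangeOrigin
import Mathlib.Analysis.SpecificLimits.Normed
import Mathlib.Analysis.Complex.Basic
import HarnessLib

/-!
# Even-jet matching across the Cayley transform

Two elementary real-analysis facts used when a smooth CLASS function is read on the two rays
through a wall point of the archimedean stable-orbital-integral families (compact ray: parameter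
`ν`, trace `2 cos ν`; split ray: parameter `x`, trace `2 cosh x`):

* `exists_contDiff_cos_eq_comp_sq` — there is ONE smooth `g : ℝ → ℝ` with `cos ν = g (ν ^ 2)` and
  `cosh x = g (-(x ^ 2))` (the entire function `∑ (-t)ⁿ / (2n)!`);
* `iteratedDeriv_comp_sq_eq_I_pow_mul_iteratedDeriv_comp_neg_sq` — for every smooth
  `H : ℝ → ℂ` and every order `i`,
  `∂ᵢ[ν ↦ H (ν²)](0) = I ^ i · ∂ᵢ[x ↦ H (−x²)](0)`:
  by the one-variable Faà di Bruno formula at `0` a term of the sum over ordered finpartitions of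
  `Fin i` survives only if every part has size `2`; then the partition has `i / 2` parts and the
  inner products are `2 ^ (i/2)` versus `(-2) ^ (i/2) = I ^ i · 2 ^ (i/2)`; for odd `i` both sides
  vanish;
* `iteratedDeriv_comp_cos_eq_I_pow_mul_iteratedDeriv_comp_cosh` — the consumable corollary
  `∂ᵢ[ν ↦ K (cos ν)](0) = I ^ i · ∂ᵢ[x ↦ K (cosh x)](0)` for every smooth `K : ℝ → ℂ`.

These are textbook facts (Faà di Bruno; `cos √t` is entire): they are the one-variable calculus
behind the compatibility of CLASS-function cut-offs with Bouaziz's jump relations `(I₃)` (the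
compact-side parameter `θ` and the split-side parameter `x` enter the trace through `cos` and `cosh`,
and `(I₃)` compares `∂_θᵏ` with `iᵏ ∂ₓᵏ`).

## References

* A. Bouaziz, *Intégrales orbitales sur les algèbres de Lie réductives*, Ann. Sci. ÉNS 27 (1994),
  §3.1 `(I₃)` p. 579 (the jump relations whose invariance under class cut-offs uses these facts).
* L. Hörmander, *The Analysis of Linear Partial Differential Operators I*, §1.1 (calculus
  background).
-/

noncomputable section

open scoped ContDiff
open Complex

namespace Literature.Analysis.Calculus

/-- The part sizes of an ordered finpartition of `Fin n` add up to `n`. [folklore] -/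
private theorem sum_partSize_eq {n : ℕ} (c : OrderedFinpartition n) : ∑ m, c.partSize m = n := by
  simpa using c.sum_sigma_eq_sum (fun _ => (1 : ℕ))

/-- The iterated derivatives of `x ↦ x ^ 2` at `0` vanish in every order except `2`. [folklore] -/
private theorem iteratedDeriv_sq_zero_of_ne_two {k : ℕ} (hk : k ≠ 2) :
    iteratedDeriv k (fun x : ℝ => x ^ 2) 0 = 0 := by
  have h1 : deriv (fun x : ℝ => x ^ 2) = fun x => 2 * x := by
    ext x; exact (hasDerivAt_pow 2 x).deriv.trans (by norm_num)
  have h2 : deriv (fun x : ℝ => 2 * x) = fun _ => (2 : ℝ) := by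
    ext x; exact ((hasDerivAt_id' x).const_mul (2 : ℝ)).deriv.trans (mul_one _)
  rcases k with _ | _ | _ | k
  · simp
  · rw [iteratedDeriv_one, h1]; simp
  · exact absurd rfl hk
  · rw [iteratedDeriv_succ', iteratedDeriv_succ', h1, h2, iteratedDeriv_succ', deriv_const',
      iteratedDeriv_const]
    simp

/-- **Even-jet matching across the Cayley transform.** For a smooth `H : ℝ → ℂ` and every order `i`,
the `i`-th derivative at `0` of `ν ↦ H (ν ^ 2)` is `I ^ i` times the `i`-th derivative at `0` of
`x ↦ H (-(x ^ 2))` (both vanish for odd `i`; for even `i` they differ by the sign `(-1) ^ (i/2)`).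
This is the calculus identity that makes a smooth class function of the trace (`2 cos θ` on the
compact ray, `2 cosh x` on the split ray) compatible with the jump relations `(I₃)`.
[cite: Bouaziz1994IntegralesOrbitales, §3.1 (I₃) p. 579] [cite: HormanderALPDO1, §1.1] -/
theorem iteratedDeriv_comp_sq_eq_I_pow_mul_iteratedDeriv_comp_neg_sq (H : ℝ → ℂ)
    (hH : ContDiff ℝ ∞ H) (i : ℕ) :
    iteratedDeriv i (fun ν : ℝ => H (ν ^ 2)) 0 =
      I ^ i * iteratedDeriv i (fun x : ℝ => H (-(x ^ 2))) 0 := by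
  have hs : ContDiff ℝ ∞ (fun x : ℝ => x ^ 2) := contDiff_id.pow 2
  have ht : ContDiff ℝ ∞ (fun x : ℝ => -(x ^ 2)) := hs.neg
  have hi : (i : ℕ∞ω) ≤ ∞ := by exact_mod_cast le_top
  have hH0 : ContDiffAt ℝ ∞ H ((fun x : ℝ => x ^ 2) 0) := hH.contDiffAt
  have hH0' : ContDiffAt ℝ ∞ H ((fun x : ℝ => -(x ^ 2)) 0) := hH.contDiffAt
  rw [show (fun ν : ℝ => H (ν ^ 2)) = H ∘ fun x : ℝ => x ^ 2 from rfl,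
    show (fun x : ℝ => H (-(x ^ 2))) = H ∘ fun x : ℝ => -(x ^ 2) from rfl,
    iteratedDeriv_scomp_eq_sum_orderedFinpartition (f := fun x : ℝ => x ^ 2) (x := 0) hH0
      hs.contDiffAt hi,
    iteratedDeriv_scomp_eq_sum_orderedFinpartition (f := fun x : ℝ => -(x ^ 2)) (x := 0) hH0'
      ht.contDiffAt hi, Finset.mul_sum]
  refine Finset.sum_congr rfl fun c _ => ?_
  simp only [ne_eq, OfNat.ofNat_ne_zero, not_false_eq_true, zero_pow, neg_zero,
    iteratedDeriv_fun_neg, Finset.prod_neg, Finset.card_univ, Fintype.card_fin]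
  by_cases hA : ∏ j, iteratedDeriv (c.partSize j) (fun x : ℝ => x ^ 2) 0 = 0
  · rw [hA, mul_zero]; simp
  · -- every part has size `2`, hence `i = 2 * c.length` and `I ^ i = (-1) ^ c.length`
    have hps : ∀ j, c.partSize j = 2 := fun j => by
      by_contra hj
      exact hA (Finset.prod_eq_zero (Finset.mem_univ j) (iteratedDeriv_sq_zero_of_ne_two hj))
    have hlen : i = 2 * c.length := by
      have := sum_partSize_eq c
      simp only [hps, Finset.sum_const, Finset.card_univ, Fintype.card_fin, smul_eq_mul] at this
      omega
    have hI : I ^ i = (-1) ^ c.length := by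
      rw [show I ^ i = I ^ (2 * c.length) from congrArg (I ^ ·) hlen, pow_mul, I_sq]
    set P : ℝ := ∏ j, iteratedDeriv (c.partSize j) (fun x : ℝ => x ^ 2) 0
    rw [hI, Complex.real_smul, Complex.real_smul]
    push_cast
    have h1 : ((-1 : ℂ) ^ c.length) * (-1) ^ c.length = 1 := by
      rw [← mul_pow]; simp
    linear_combination (-((P : ℂ) * iteratedDeriv c.length H 0)) * h1

/-- The power series `∑ (-1)ⁿ tⁿ / (2n)!` has infinite radius of convergence (comparison with the
exponential series). [folklore] -/
private theorem radius_cosSqCoeff :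
    (FormalMultilinearSeries.ofScalars ℝ (fun n : ℕ => (-1 : ℝ) ^ n / (2 * n).factorial)).radius
      = ⊤ := by
  refine FormalMultilinearSeries.radius_eq_top_of_summable_norm _ fun r => ?_
  refine (Real.summable_pow_div_factorial (r : ℝ)).of_nonneg_of_le
    (fun n => by positivity) fun n => ?_
  rw [FormalMultilinearSeries.ofScalars_norm, norm_div, norm_pow, norm_neg, norm_one,
    one_pow, Real.norm_natCast, div_mul_eq_mul_div, one_mul]
  gcongr
  omega

/-- **`cos` and `cosh` are one smooth function of `± (argument)²`.** There is a smooth `g : ℝ → ℝ`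
(namely `g t = ∑ (-t)ⁿ / (2n)!`) with `cos ν = g (ν ^ 2)` and `cosh x = g (-(x ^ 2))` — the two
traces `2 cos θ`, `2 cosh x` at a wall are ONE smooth class function of `± (parameter)²`.
[cite: Bouaziz1994IntegralesOrbitales, §3.1 (I₃) p. 579] [cite: HormanderALPDO1, §1.1] -/
theorem exists_contDiff_cos_eq_comp_sq :
    ∃ g : ℝ → ℝ, ContDiff ℝ ∞ g ∧ (∀ ν : ℝ, Real.cos ν = g (ν ^ 2)) ∧
      ∀ x : ℝ, Real.cosh x = g (-(x ^ 2)) := by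
  let p := FormalMultilinearSeries.ofScalars ℝ (fun n : ℕ => (-1 : ℝ) ^ n / (2 * n).factorial)
  have hrad : p.radius = ⊤ := radius_cosSqCoeff
  have hball : HasFPowerSeriesOnBall p.sum p 0 p.radius :=
    p.hasFPowerSeriesOnBall (by rw [hrad]; exact ENNReal.zero_lt_top)
  have hsmooth : ContDiff ℝ ∞ p.sum := by
    refine AnalyticOnNhd.contDiff fun y _ => hball.analyticAt_of_mem ?_
    rw [hrad]; simp
  have hsum : ∀ t : ℝ, p.sum t = ∑' n : ℕ, (-1) ^ n / (2 * n).factorial * t ^ n := fun t => by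
    change FormalMultilinearSeries.ofScalarsSum _ t = _
    rw [FormalMultilinearSeries.ofScalars_sum_eq]
    simp [smul_eq_mul]
  refine ⟨p.sum, hsmooth, fun ν => ?_, fun x => ?_⟩
  · rw [hsum, ← (Real.hasSum_cos ν).tsum_eq]
    refine tsum_congr fun n => ?_
    rw [pow_mul]; ring
  · rw [hsum, ← (Real.hasSum_cosh x).tsum_eq]
    refine tsum_congr fun n => ?_
    rw [pow_mul, neg_pow (x ^ 2) n]
    have h1 : ((-1 : ℝ) ^ n) * (-1) ^ n = 1 := by rw [← mul_pow]; simp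
    linear_combination (-((x ^ 2) ^ n / ((2 * n).factorial : ℝ))) * h1

/-- **Jets of a class function at a wall: `cos` side versus `cosh` side.** For every smooth
`K : ℝ → ℂ` and every order `i`,
`∂ᵢ[ν ↦ K (cos ν)](0) = I ^ i · ∂ᵢ[x ↦ K (cosh x)](0)` — the form consumed when a smooth class
function of the trace is read along the compact ray (`2 cos ν`) and the split ray (`2 cosh x`)
through a wall point. [cite: Bouaziz1994IntegralesOrbitales, §3.1 (I₃) p. 579]
[cite: HormanderALPDO1, §1.1] -/
theorem iteratedDeriv_comp_cos_eq_I_pow_mul_iteratedDeriv_comp_cosh (K : ℝ → ℂ)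
    (hK : ContDiff ℝ ∞ K) (i : ℕ) :
    iteratedDeriv i (fun ν : ℝ => K (Real.cos ν)) 0 =
      I ^ i * iteratedDeriv i (fun x : ℝ => K (Real.cosh x)) 0 := by
  obtain ⟨g, hg, hcos, hcosh⟩ := exists_contDiff_cos_eq_comp_sq
  have h1 : (fun ν : ℝ => K (Real.cos ν)) = fun ν => (K ∘ g) (ν ^ 2) := funext fun ν => by
    rw [Function.comp_apply, ← hcos]
  have h2 : (fun x : ℝ => K (Real.cosh x)) = fun x => (K ∘ g) (-(x ^ 2)) := funext fun x => by
    rw [Function.comp_apply, ← hcosh]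
  rw [h1, h2]
  exact iteratedDeriv_comp_sq_eq_I_pow_mul_iteratedDeriv_comp_neg_sq (K ∘ g) (hK.comp hg) i

end Literature.Analysis.Calculus
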